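import Summits.FinalStateConjecture.FinalStateConjecture.Theses.SuperenergyCensus

/-!
# Birth skeleton for crux `InvertedQuantumCensus` (stmt-FinalStateConjecture-10095) of route
`SuperenergyCensus` — file `Cruxes/InvertedQuantumCensus/Lines/birth.lean` (BC3, skeleton-register)

THE CRUX AS TYPED (THE CENSUS). For every spacetime `𝓢`, region `O`, index type `ι`, parameters
`(Mᵢ, aᵢ)`, motions `(Λᵢ, cᵢ)`, `τ₀` and hole charts `Ψᵢ` on the boosted Kerr exteriors that are late
charts into `O`, sub-extremal and `C²`-settling on every truncated slab `{t*ᵢ = τ, rᵢ ≤ R}`: bounded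
masses `Mᵢ ≤ K` and ONE bound `∃ C < ∞, ∀ finite s ⊆ ι, ∃ᶠ τ, Σ_{i∈s} 𝓔ᵢ(τ) ≤ C` on the coordinate
Bel–Robinson collar superenergies `𝓔ᵢ(τ) = (1/8)∫_{t*ᵢ = τ, r₊ < rᵢ ≤ 4Mᵢ} |Rm_{Ψᵢ*g}|²_ĝ dμ_H³` force
`Finite ι`.

THE TYPED `ĝ` (read this first; refuter rreview-0815T15-5, notes of 2026-08-15 on items 10094/10095/10097,
Lean evidence `Scratch2.lean` attached to stmt-FinalStateConjecture-10097). In all three route items the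
modified metric inside `tnormSq` is typed `G z + (2 * (-(dT (sharpAt G z dT))))⁻¹ • dT⊗dT`, i.e. with
coefficient `(2·(−G⁻¹(dT,dT)))⁻¹ = N²/2` (`N² := −1/G⁻¹(dT,dT)`), NOT the docstrings' intended `2N²`: the
typed `ĝ = g + ½ n♭⊗n♭` is still LORENTZIAN (`ĝ(n,n) = −1/2`) but NONDEGENERATE, and the typed density is
`ofReal((1/8)|Rm|²_ĝ) = ofReal(2.5|E|² − 2|B|²)` in vacuum (negative part truncated by `ENNReal.ofReal`)
instead of the Bel–Robinson `W = |E|² + |B|²`. The crux is FIXED as typed and this skeleton is written for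
the typed quantity throughout (every functional below is byte-identical to the route's subterms): stub 1
needs only nondegeneracy of the typed `ĝ` near the background jets (true), stub 2 only covariance (true
for any coefficient built from `G` and `dT`), stub 3 is the route's floor item AS TYPED (refuter: "probably
still TRUE"; its `a = 0` value is `35π/(16M)`, not the `W`-calibration `7π/(8M)` of kit j001624 — do not
import `W`-based numerics). RESTATE WATCH: if the planner applies the refuter's one-token FIX (move the
`⁻¹` inside: `(2 * (-(…))⁻¹) •`) to the three items, the crux becomes a new decl and this file needs the
same patch at its 9 occurrences of `))))⁻¹) • E4.tmul` (2 + 2 in `CollarContinuity`/`stub_collarContinuity`,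
2 + 2 in `BoostInflatesCollar`/`stub_boostInflatesCollar`, 1 in `stub_kerrCollarFloor`) and nothing else.

THE LINE (the route's own announced cut "C ⇐ (coordinate-curvature continuity under C² deviation) →
(Lorentz-Jacobian + Kerr calibration) → C", with the counting PROVED here):

* `stub_collarContinuity` — CONTINUITY OF THE COLLAR FUNCTIONAL (the analytic stub; size M–L). For ONE
  hole chart with the crux's per-hole hypotheses (sub-extremal, late chart, truncated `C²` deviation
  `→ 0` for every `R`), the collar superenergy `𝓔(τ)` CONVERGES, as `τ → ∞`, to the collar superenergy
  of the exact boosted Kerr–Schild background at boosted time `0`. Proof idea: by stationarity of the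
  boosted Kerr–Schild background under `y ↦ y + τ·Λe₀` (an isometry of `E4`, so `μ_H³`-preserving) the
  collar `{t* = τ, r₊ < r ≤ 4M}` is a translate of the bounded collar at `t* = 0` and the background
  2-jet ranges in a fixed compact set on which `g` (Kerr–Schild: `det g = −1`) and the typed
  `ĝ = g + (N²/2) dt*⊗dt*` are uniformly NONDEGENERATE (`g⁻¹(dt*,dt*) = −(1 + f) ≤ −1`, so `N² ∈ (0, 1]`
  and `ĝ(n,n) = −1/2`, down to and through `r₊ > 0`); the density `(G, DG, D²G) ↦ (1/8)|Rm_G|²_ĝ` is a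
  rational, hence locally Lipschitz, function of the 2-jet there and `ENNReal.ofReal` is 1-Lipschitz, so
  the `C²` sup-norm convergence on the slab `{t* = τ, r ≤ 4M} ⊇ collar` (which is
  `truncDeviationCk … 2 (4M) τ → 0`, all `E4`-derivatives of order `≤ 2`) gives uniform convergence of
  the integrand on a set of finite, `τ`-independent `μ_H³`-measure.
  Why it might fail: only through lost uniformity at the open inner edge `r → r₊⁺` — excluded here
  because Kerr–Schild coordinates are regular across `r₊` and the sup norm is taken on the half-open
  slab itself; positivity of `ĝ` is NOT needed (and not available as typed).
* `stub_boostInflatesCollar` — LORENTZ COVARIANCE + SLAB JACOBIAN `≥ 1` (exact-background stub; size M).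
  For sub-extremal `(M, a)` and ANY motion `(Λ, c)`, the rest-frame Kerr–Schild collar functional
  `𝓔_KS(M, a)` (verbatim the right side of the support item `KerrCollarSuperenergyFloor`) is `≤` the
  boosted background's collar functional at boosted time `0`. Proof idea: the density is a full
  contraction of coordinate tensors, hence invariant under the AFFINE map `P : x ↦ Λx + c`
  (`boostedKerrBilin`, `(boostedKerrBackground …).time = x⁰ ∘ P⁻¹`, `radius = r ∘ P⁻¹` are the
  `P⁻¹`-pullbacks; Christoffel symbols transform tensorially under affine maps), the boosted collar is
  `P`(rest collar) (`r₊ > 0` by sub-extremality, so `Kerr.exterior = {r₊ < r}`), and `μ_H³` on the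
  spacelike hyperplane `{x⁰ = 0}` is multiplied under `Λ` by the Euclidean 3-Jacobian
  `J(Λ) = √det(I + 2bbᵀ) = √(1 + 2|b|²) ≥ 1`, `bₖ = (Λeₖ)⁰` (Euclidean Gram of an `η`-orthonormal
  spacelike triple). So boosted value `= J(Λ)·𝓔_KS(M, a) ≥ 𝓔_KS(M, a)`.
  Why it might fail: only if the prelude's coordinate calculus (`MetricCoord.rm4` / `tnormSq` /
  `sharpAt`) were not affinely covariant — it is the honest tensor calculus in the fixed basis.
* `stub_kerrCollarFloor` — THE KERR CALIBRATION, by name: the route's support item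
  `KerrCollarSuperenergyFloor` (stmt-FinalStateConjecture-10097; `∃ c > 0, ∀ 0 < M, |a| ≤ M,
  c/M ≤ 𝓔_KS(M, a)` AS TYPED; scaling `x ↦ Mx` + lower semicontinuity/positivity in `χ = a/M ∈ [-1, 1]`:
  at `r = 4M` one has `a|cos θ|/r ≤ 1/4`, outside the cone where the typed integrand `2.5|E|² − 2|B|²` is
  negative, so its positive part has positive measure for every `χ`; the `W`-numerics of kit j001624,
  `M·𝓔 = 7π/8 … 40.07`, are for the INTENDED quantity — the typed `a = 0` value is `35π/16`). Discharged
  by `KerrCollarSuperenergyFloor_holds` once that item closes; registered here so the line's obligations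
  are complete.

`InvertedQuantumCensus_of` (kernel-checked, no `sorry` of its own) is the COUNTING: from the three
stubs every hole is eventually charged `𝓔ᵢ(τ) > c/(2Mᵢ) ≥ c/(2K)` (`0 < Mᵢ` from sub-extremality;
`Tendsto.eventually_const_lt`); for a finite `s ⊆ ι` the charges hold simultaneously eventually, the
sum bound holds frequently, so at some `τ` both: `|s|·c/(2K) ≤ Σ_{i∈s} 𝓔ᵢ(τ) ≤ C < ∞`; finsets of
bounded cardinality force `Finite ι` (`finite_of_frequently_sum_le`, proved below:
`ENNReal.exists_nat_mul_gt` + `Infinite.exists_subset_card_eq`). Duplicated charts are charged per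
index, so no disjointness is used — exactly as the route text says.

Conventions (as in the other birth skeletons of this summit): the stub statements are recorded as
named propositions `CollarContinuity`, `BoostInflatesCollar` with `Sig.stub_*` abbreviations (the
skeleton audit reads the hypotheses of `InvertedQuantumCensus_of` BY NAME — each head must be a
declared stub or a tagged route item; the third hypothesis is the route item
`KerrCollarSuperenergyFloor` itself, and `stub_kerrCollarFloor` is its body verbatim), the stubs are
stated EXPANDED over tree declarations (the collar functional is byte-identical to the crux's summand
with `(motion i, mass i, spin i, chart i)` specialised to one hole; `𝓔_KS` is byte-identical to the
right side of `KerrCollarSuperenergyFloor`), `sorry` occurs only in the three `stub_*` theorems, and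
the closing `example`s are the kernel check that the stub statements are literally the hypotheses
of `InvertedQuantumCensus_of`.
Disproof used: none exists for this crux (`ledger crux ls stmt-FinalStateConjecture-10095`: no
workfiles, 2026-08-17); no `Theorems/InvertedQuantumCensus/Negative/` lemmas; negatives index of the
summit has no statement about collar superenergies.
-/

namespace Summit.FinalStateConjecture.FinalStateConjecture.Cruxes.InvertedQuantumCensus.Birth

open scoped BigOperators Topology ENNReal
open Filter Set MeasureTheory
open Summit.FinalStateConjecture.FinalStateConjecture.Theses.SuperenergyCensus

/-! ## Statements of the stubs as named propositions -/

/-- Statement of `stub_collarContinuity`: for one settled hole chart, the collar superenergy `𝓔(τ)`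
tends, as `τ → ∞`, to the collar superenergy of the exact boosted Kerr–Schild background (boosted
time `0`). -/
def CollarContinuity : Prop :=
  ∀ (𝓢 : Literature.Geometry.Lorentzian.Spacetime.{0} 4) (O : Set 𝓢.carrier) (M a : ℝ) (Λ : Literature.Geometry.Lorentzian.lorentzGroup) (ctr : Literature.Geometry.Lorentzian.E4) (τ₀ : ℝ) (chart : Literature.Geometry.Lorentzian.boostedKerrExterior Λ ctr M a → 𝓢.carrier), Literature.Geometry.Lorentzian.Kerr.IsSubextremal M a → 𝓢.IsLateChart (Literature.Geometry.Lorentzian.boostedKerrBackground Λ ctr M a) O τ₀ chart → (∀ R : ℝ, Filter.Tendsto (fun τ ↦ 𝓢.truncDeviationCk (Literature.Geometry.Lorentzian.boostedKerrBackground Λ ctr M a) chart 2 R τ) Filter.atTop (nhds 0)) → Filter.Tendsto (fun τ ↦ MeasureTheory.lintegral ((MeasureTheory.Measure.hausdorffMeasure 3).restrict {y : Literature.Geometry.Lorentzian.E4 | y ∈ (Literature.Geometry.Lorentzian.boostedKerrBackground Λ ctr M a).domain ∧ (Literature.Geometry.Lorentzian.boostedKerrBackground Λ ctr M a).time y = τ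 ∧ (Literature.Geometry.Lorentzian.boostedKerrBackground Λ ctr M a).radius y ≤ 4 * M}) (fun y ↦ ENNReal.ofReal ((1 / 8 : ℝ) * Literature.Geometry.Lorentzian.MetricCoord.tnormSq (fun z ↦ 𝓢.deviationExtend (Literature.Geometry.Lorentzian.boostedKerrBackground Λ ctr M a) chart z + (Literature.Geometry.Lorentzian.boostedKerrBackground Λ ctr M a).bilin z + (2 * (-((fderiv ℝ (Literature.Geometry.Lorentzian.boostedKerrBackground Λ ctr M a).time z) (Literature.Geometry.Lorentzian.MetricCoord.sharpAt (fun w ↦ 𝓢.deviationExtend (Literature.Geometry.Lorentzian.boostedKerrBackground Λ ctr M a) chart w + (Literature.Geometry.Lorentzian.boostedKerrBackground Λ ctr M a).bilin w) z (fderiv ℝ (Literature.Geometry.Lorentzian.boostedKerrBackground Λ ctr M a).time z))))⁻¹) • Literature.Geometry.Lorentzian.E4.tmul (fderiv ℝ (Literature.Geometry.Lorentzian.boostedKerrBackground Λ ctr M a).time z) (fderiv ℝ (Literature.Geometry.Lorentzian.boostedKerrBackground Λ ctr M a).time z)) (EuclideanSpace.basisFun (Fin 4) ℝ).toBasis (Literature.Geometry.Lorentzian.MetricCoord.rm4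 (fun w ↦ 𝓢.deviationExtend (Literature.Geometry.Lorentzian.boostedKerrBackground Λ ctr M a) chart w + (Literature.Geometry.Lorentzian.boostedKerrBackground Λ ctr M a).bilin w) (EuclideanSpace.basisFun (Fin 4) ℝ).toBasis) y))) Filter.atTop (nhds (MeasureTheory.lintegral ((MeasureTheory.Measure.hausdorffMeasure 3).restrict {y : Literature.Geometry.Lorentzian.E4 | y ∈ (Literature.Geometry.Lorentzian.boostedKerrBackground Λ ctr M a).domain ∧ (Literature.Geometry.Lorentzian.boostedKerrBackground Λ ctr M a).time y = 0 ∧ (Literature.Geometry.Lorentzian.boostedKerrBackground Λ ctr M a).radius y ≤ 4 * M}) (fun y ↦ ENNReal.ofReal ((1 / 8 : ℝ) * Literature.Geometry.Lorentzian.MetricCoord.tnormSq (fun z ↦ (Literature.Geometry.Lorentzian.boostedKerrBackground Λ ctr M a).bilin z + (2 * (-((fderiv ℝ (Literature.Geometry.Lorentzian.boostedKerrBackground Λ ctr M a).time z) (Literature.Geometry.Lorentzian.MetricCoord.sharpAt (Literature.Geometry.Lorentzian.boostedKerrBackground Λ ctr M a).bilin z (fderiv ℝ (Literature.Geometry.Lorentzian.boostedKerrBackground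 Λ ctr M a).time z))))⁻¹) • Literature.Geometry.Lorentzian.E4.tmul (fderiv ℝ (Literature.Geometry.Lorentzian.boostedKerrBackground Λ ctr M a).time z) (fderiv ℝ (Literature.Geometry.Lorentzian.boostedKerrBackground Λ ctr M a).time z)) (EuclideanSpace.basisFun (Fin 4) ℝ).toBasis (Literature.Geometry.Lorentzian.MetricCoord.rm4 (Literature.Geometry.Lorentzian.boostedKerrBackground Λ ctr M a).bilin (EuclideanSpace.basisFun (Fin 4) ℝ).toBasis) y))))

/-- Statement of `stub_boostInflatesCollar`: boosting/translating a sub-extremal Kerr–Schild background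
does not decrease the collar functional (Lorentz covariance of the density, slab Jacobian `≥ 1`). -/
def BoostInflatesCollar : Prop :=
  ∀ (M a : ℝ) (Λ : Literature.Geometry.Lorentzian.lorentzGroup) (ctr : Literature.Geometry.Lorentzian.E4), Literature.Geometry.Lorentzian.Kerr.IsSubextremal M a → MeasureTheory.lintegral ((MeasureTheory.Measure.hausdorffMeasure 3).restrict {y : Literature.Geometry.Lorentzian.E4 | Literature.Geometry.Lorentzian.Kerr.rPlus M a < Literature.Geometry.Lorentzian.Kerr.radius a y ∧ y 0 = 0 ∧ Literature.Geometry.Lorentzian.Kerr.radius a y ≤ 4 * M}) (fun y ↦ ENNReal.ofReal ((1 / 8 : ℝ) * Literature.Geometry.Lorentzian.MetricCoord.tnormSq (fun z ↦ (Literature.Geometry.Lorentzian.Kerr.bilin M a) z + (2 * (-((fderiv ℝ (fun w : Literature.Geometry.Lorentzian.E4 ↦ w 0) z) (Literature.Geometry.Lorentzian.MetricCoord.sharpAt (Literature.Geometry.Lorentzian.Kerr.bilin M a) z (fderiv ℝ (fun w : Literature.Geometry.Lorentzian.E4 ↦ w 0) z))))⁻¹) • Literature.Geometry.Lorentzian.E4.tmul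 (fderiv ℝ (fun w : Literature.Geometry.Lorentzian.E4 ↦ w 0) z) (fderiv ℝ (fun w : Literature.Geometry.Lorentzian.E4 ↦ w 0) z)) (EuclideanSpace.basisFun (Fin 4) ℝ).toBasis (Literature.Geometry.Lorentzian.MetricCoord.rm4 (Literature.Geometry.Lorentzian.Kerr.bilin M a) (EuclideanSpace.basisFun (Fin 4) ℝ).toBasis) y)) ≤ MeasureTheory.lintegral ((MeasureTheory.Measure.hausdorffMeasure 3).restrict {y : Literature.Geometry.Lorentzian.E4 | y ∈ (Literature.Geometry.Lorentzian.boostedKerrBackground Λ ctr M a).domain ∧ (Literature.Geometry.Lorentzian.boostedKerrBackground Λ ctr M a).time y = 0 ∧ (Literature.Geometry.Lorentzian.boostedKerrBackground Λ ctr M a).radius y ≤ 4 * M}) (fun y ↦ ENNReal.ofReal ((1 / 8 : ℝ) * Literature.Geometry.Lorentzian.MetricCoord.tnormSq (fun z ↦ (Literature.Geometry.Lorentzian.boostedKerrBackground Λ ctr M a).bilin z + (2 * (-((fderiv ℝ (Literature.Geometry.Lorentzian.boostedKerrBackground Λ ctr M a).time z) (Literature.Geometry.Lorentzian.MetricCoord.sharpAt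 (Literature.Geometry.Lorentzian.boostedKerrBackground Λ ctr M a).bilin z (fderiv ℝ (Literature.Geometry.Lorentzian.boostedKerrBackground Λ ctr M a).time z))))⁻¹) • Literature.Geometry.Lorentzian.E4.tmul (fderiv ℝ (Literature.Geometry.Lorentzian.boostedKerrBackground Λ ctr M a).time z) (fderiv ℝ (Literature.Geometry.Lorentzian.boostedKerrBackground Λ ctr M a).time z)) (EuclideanSpace.basisFun (Fin 4) ℝ).toBasis (Literature.Geometry.Lorentzian.MetricCoord.rm4 (Literature.Geometry.Lorentzian.boostedKerrBackground Λ ctr M a).bilin (EuclideanSpace.basisFun (Fin 4) ℝ).toBasis) y))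

namespace Sig
/-- Statement of `stub_collarContinuity`, under the stub's name. -/
abbrev stub_collarContinuity : Prop := CollarContinuity
/-- Statement of `stub_boostInflatesCollar`, under the stub's name. -/
abbrev stub_boostInflatesCollar : Prop := BoostInflatesCollar
end Sig

/-! ## Registered stubs (the only `sorry`s of the file), stated expanded -/

/-- stub 1 — CONTINUITY OF THE COLLAR FUNCTIONAL under `C²` settling (the analytic stub). For a
spacetime `𝓢`, a region `O`, sub-extremal `(M, a)`, a motion `(Λ, ctr)`, a late chart `chart` on the
boosted Kerr exterior whose truncated `C²` deviation from boosted Kerr tends to `0` on every slab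
`{t* = τ, r ≤ R}`: the collar superenergy `(1/8)∫_{t* = τ, r₊ < r ≤ 4M} |Rm_G|²_ĝ dμ_H³`,
`G = chart^*g` in boosted Kerr–Schild coordinates, `ĝ = G + (N²/2) dt*⊗dt*` AS TYPED (nondegenerate
Lorentzian, `ĝ(n,n) = −1/2`; see the header), tends to the same functional of the exact boosted
background on the collar at boosted time `0` (stationarity: every collar is a translate of that one).
Uniform convergence of a locally Lipschitz function of the 2-jet (composed with the 1-Lipschitz
`ENNReal.ofReal`) on a bounded collar of finite, `τ`-independent `μ_H³`-measure; `dt*` uniformly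
timelike, `det g = −1`, and the background smooth across `r₊ > 0`. -/
theorem stub_collarContinuity :
    ∀ (𝓢 : Literature.Geometry.Lorentzian.Spacetime.{0} 4) (O : Set 𝓢.carrier) (M a : ℝ) (Λ : Literature.Geometry.Lorentzian.lorentzGroup) (ctr : Literature.Geometry.Lorentzian.E4) (τ₀ : ℝ) (chart : Literature.Geometry.Lorentzian.boostedKerrExterior Λ ctr M a → 𝓢.carrier), Literature.Geometry.Lorentzian.Kerr.IsSubextremal M a → 𝓢.IsLateChart (Literature.Geometry.Lorentzian.boostedKerrBackground Λ ctr M a) O τ₀ chart → (∀ R : ℝ, Filter.Tendsto (fun τ ↦ 𝓢.truncDeviationCk (Literature.Geometry.Lorentzian.boostedKerrBackground Λ ctr M a) chart 2 R τ) Filter.atTop (nhds 0)) → Filter.Tendsto (fun τ ↦ MeasureTheory.lintegral ((MeasureTheory.Measure.hausdorffMeasure 3).restrict {y : Literature.Geometry.Lorentzian.E4 | y ∈ (Literature.Geometry.Lorentzian.boostedKerrBackground Λ ctr M a).domain ∧ (Literature.Geometry.Lorentzian.boostedKerrBackground Λ ctr M a).time y = τ ∧ (Literature.Geometry.Lorentzian.boostedKerrBackground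 Λ ctr M a).radius y ≤ 4 * M}) (fun y ↦ ENNReal.ofReal ((1 / 8 : ℝ) * Literature.Geometry.Lorentzian.MetricCoord.tnormSq (fun z ↦ 𝓢.deviationExtend (Literature.Geometry.Lorentzian.boostedKerrBackground Λ ctr M a) chart z + (Literature.Geometry.Lorentzian.boostedKerrBackground Λ ctr M a).bilin z + (2 * (-((fderiv ℝ (Literature.Geometry.Lorentzian.boostedKerrBackground Λ ctr M a).time z) (Literature.Geometry.Lorentzian.MetricCoord.sharpAt (fun w ↦ 𝓢.deviationExtend (Literature.Geometry.Lorentzian.boostedKerrBackground Λ ctr M a) chart w + (Literature.Geometry.Lorentzian.boostedKerrBackground Λ ctr M a).bilin w) z (fderiv ℝ (Literature.Geometry.Lorentzian.boostedKerrBackground Λ ctr M a).time z))))⁻¹) • Literature.Geometry.Lorentzian.E4.tmul (fderiv ℝ (Literature.Geometry.Lorentzian.boostedKerrBackground Λ ctr M a).time z) (fderiv ℝ (Literature.Geometry.Lorentzian.boostedKerrBackground Λ ctr M a).time z)) (EuclideanSpace.basisFun (Fin 4) ℝ).toBasis (Literature.Geometry.Lorentzian.MetricCoord.rm4 (fun w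 ↦ 𝓢.deviationExtend (Literature.Geometry.Lorentzian.boostedKerrBackground Λ ctr M a) chart w + (Literature.Geometry.Lorentzian.boostedKerrBackground Λ ctr M a).bilin w) (EuclideanSpace.basisFun (Fin 4) ℝ).toBasis) y))) Filter.atTop (nhds (MeasureTheory.lintegral ((MeasureTheory.Measure.hausdorffMeasure 3).restrict {y : Literature.Geometry.Lorentzian.E4 | y ∈ (Literature.Geometry.Lorentzian.boostedKerrBackground Λ ctr M a).domain ∧ (Literature.Geometry.Lorentzian.boostedKerrBackground Λ ctr M a).time y = 0 ∧ (Literature.Geometry.Lorentzian.boostedKerrBackground Λ ctr M a).radius y ≤ 4 * M}) (fun y ↦ ENNReal.ofReal ((1 / 8 : ℝ) * Literature.Geometry.Lorentzian.MetricCoord.tnormSq (fun z ↦ (Literature.Geometry.Lorentzian.boostedKerrBackground Λ ctr M a).bilin z + (2 * (-((fderiv ℝ (Literature.Geometry.Lorentzian.boostedKerrBackground Λ ctr M a).time z) (Literature.Geometry.Lorentzian.MetricCoord.sharpAt (Literature.Geometry.Lorentzian.boostedKerrBackground Λ ctr M a).bilin z (fderiv ℝ (Literature.Geometry.Lorentzian.boostedKerrBackground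 Λ ctr M a).time z))))⁻¹) • Literature.Geometry.Lorentzian.E4.tmul (fderiv ℝ (Literature.Geometry.Lorentzian.boostedKerrBackground Λ ctr M a).time z) (fderiv ℝ (Literature.Geometry.Lorentzian.boostedKerrBackground Λ ctr M a).time z)) (EuclideanSpace.basisFun (Fin 4) ℝ).toBasis (Literature.Geometry.Lorentzian.MetricCoord.rm4 (Literature.Geometry.Lorentzian.boostedKerrBackground Λ ctr M a).bilin (EuclideanSpace.basisFun (Fin 4) ℝ).toBasis) y)))) := by
  sorry

/-- stub 2 — BOOSTS INFLATE THE COLLAR (Lorentz covariance + slab Jacobian). For sub-extremal `(M, a)`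
and any `(Λ, ctr)`: the rest-frame Kerr–Schild collar functional `𝓔_KS(M, a)` (verbatim the right side
of `KerrCollarSuperenergyFloor`) is at most the boosted background's collar functional at boosted time
`0`; in fact the latter equals `J(Λ)·𝓔_KS(M, a)` with `J(Λ) = √(1 + 2|b|²) ≥ 1`, `bₖ = (Λeₖ)⁰`, the
Euclidean 3-Jacobian of `Λ` on the hyperplane `{x⁰ = 0}` (the density is an affine scalar, the boosted
collar is the Poincaré image of the rest collar since `r₊ > 0`). -/
theorem stub_boostInflatesCollar :
    ∀ (M a : ℝ) (Λ : Literature.Geometry.Lorentzian.lorentzGroup) (ctr : Literature.Geometry.Lorentzian.E4), Literature.Geometry.Lorentzian.Kerr.IsSubextremal M a → MeasureTheory.lintegral ((MeasureTheory.Measure.hausdorffMeasure 3).restrict {y : Literature.Geometry.Lorentzian.E4 | Literature.Geometry.Lorentzian.Kerr.rPlus M a < Literature.Geometry.Lorentzian.Kerr.radius a y ∧ y 0 = 0 ∧ Literature.Geometry.Lorentzian.Kerr.radius a y ≤ 4 * M}) (fun y ↦ ENNReal.ofReal ((1 / 8 : ℝ) * Literature.Geometry.Lorentzian.MetricCoord.tnormSq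 (fun z ↦ (Literature.Geometry.Lorentzian.Kerr.bilin M a) z + (2 * (-((fderiv ℝ (fun w : Literature.Geometry.Lorentzian.E4 ↦ w 0) z) (Literature.Geometry.Lorentzian.MetricCoord.sharpAt (Literature.Geometry.Lorentzian.Kerr.bilin M a) z (fderiv ℝ (fun w : Literature.Geometry.Lorentzian.E4 ↦ w 0) z))))⁻¹) • Literature.Geometry.Lorentzian.E4.tmul (fderiv ℝ (fun w : Literature.Geometry.Lorentzian.E4 ↦ w 0) z) (fderiv ℝ (fun w : Literature.Geometry.Lorentzian.E4 ↦ w 0) z)) (EuclideanSpace.basisFun (Fin 4) ℝ).toBasis (Literature.Geometry.Lorentzian.MetricCoord.rm4 (Literature.Geometry.Lorentzian.Kerr.bilin M a) (EuclideanSpace.basisFun (Fin 4) ℝ).toBasis) y)) ≤ MeasureTheory.lintegral ((MeasureTheory.Measure.hausdorffMeasure 3).restrict {y : Literature.Geometry.Lorentzian.E4 | y ∈ (Literature.Geometry.Lorentzian.boostedKerrBackground Λ ctr M a).domain ∧ (Literature.Geometry.Lorentzian.boostedKerrBackground Λ ctr M a).time y = 0 ∧ (Literature.Geometry.Lorentzian.boostedKerrBackground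 Λ ctr M a).radius y ≤ 4 * M}) (fun y ↦ ENNReal.ofReal ((1 / 8 : ℝ) * Literature.Geometry.Lorentzian.MetricCoord.tnormSq (fun z ↦ (Literature.Geometry.Lorentzian.boostedKerrBackground Λ ctr M a).bilin z + (2 * (-((fderiv ℝ (Literature.Geometry.Lorentzian.boostedKerrBackground Λ ctr M a).time z) (Literature.Geometry.Lorentzian.MetricCoord.sharpAt (Literature.Geometry.Lorentzian.boostedKerrBackground Λ ctr M a).bilin z (fderiv ℝ (Literature.Geometry.Lorentzian.boostedKerrBackground Λ ctr M a).time z))))⁻¹) • Literature.Geometry.Lorentzian.E4.tmul (fderiv ℝ (Literature.Geometry.Lorentzian.boostedKerrBackground Λ ctr M a).time z) (fderiv ℝ (Literature.Geometry.Lorentzian.boostedKerrBackground Λ ctr M a).time z)) (EuclideanSpace.basisFun (Fin 4) ℝ).toBasis (Literature.Geometry.Lorentzian.MetricCoord.rm4 (Literature.Geometry.Lorentzian.boostedKerrBackground Λ ctr M a).bilin (EuclideanSpace.basisFun (Fin 4) ℝ).toBasis) y)) := by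
  sorry

/-- stub 3 — THE KERR CALIBRATION: the route's support item `KerrCollarSuperenergyFloor`
(stmt-FinalStateConjecture-10097) — `∃ c > 0, ∀ 0 < M, |a| ≤ M, c/M ≤ 𝓔_KS(M, a)` AS TYPED
(scaling `x ↦ Mx`; lower semicontinuity and positivity of `χ ↦ 𝓔_KS(1, χ)` on `[-1, 1]`, the typed
integrand `ofReal(2.5|E|² − 2|B|²)` being positive near `r = 4M` for every `χ`; typed `a = 0` value
`35π/(16M)` — not the `W`-value `7π/(8M)` of kit j001624). Stated expanded: the body of the route item
verbatim, so that the hand-over `stub ↦ item` in the closing `example` is definitional; closed by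
`KerrCollarSuperenergyFloor_holds` when the item is proved. -/
theorem stub_kerrCollarFloor :
    ∃ c : ℝ, 0 < c ∧ ∀ M a : ℝ, 0 < M → |a| ≤ M → ENNReal.ofReal (c / M) ≤ MeasureTheory.lintegral ((MeasureTheory.Measure.hausdorffMeasure 3).restrict {y : Literature.Geometry.Lorentzian.E4 | Literature.Geometry.Lorentzian.Kerr.rPlus M a < Literature.Geometry.Lorentzian.Kerr.radius a y ∧ y 0 = 0 ∧ Literature.Geometry.Lorentzian.Kerr.radius a y ≤ 4 * M}) (fun y ↦ ENNReal.ofReal ((1 / 8 : ℝ) * Literature.Geometry.Lorentzian.MetricCoord.tnormSq (fun z ↦ (Literature.Geometry.Lorentzian.Kerr.bilin M a) z + (2 * (-((fderiv ℝ (fun w : Literature.Geometry.Lorentzian.E4 ↦ w 0) z) (Literature.Geometry.Lorentzian.MetricCoord.sharpAt (Literature.Geometry.Lorentzian.Kerr.bilin M a) z (fderiv ℝ (fun w : Literature.Geometry.Lorentzian.E4 ↦ w 0) z))))⁻¹) • Literature.Geometry.Lorentzian.E4.tmul (fderiv ℝ (fun w : Literature.Geometry.Lorentzian.E4 ↦ w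 0) z) (fderiv ℝ (fun w : Literature.Geometry.Lorentzian.E4 ↦ w 0) z)) (EuclideanSpace.basisFun (Fin 4) ℝ).toBasis (Literature.Geometry.Lorentzian.MetricCoord.rm4 (Literature.Geometry.Lorentzian.Kerr.bilin M a) (EuclideanSpace.basisFun (Fin 4) ℝ).toBasis) y)) := by
  sorry

/-! Consistency (elaborated, not kept): each expanded stub statement is the named proposition the
composition consumes (for stub 3: the route item `KerrCollarSuperenergyFloor`, definitionally). -/
example : Sig.stub_collarContinuity := stub_collarContinuity
example : Sig.stub_boostInflatesCollar := stub_boostInflatesCollar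
example : KerrCollarSuperenergyFloor := stub_kerrCollarFloor

/-! ## The counting lemma and the composition (kernel-checked; no `sorry` of their own) -/

/-- COUNTING (pure bookkeeping, proved): if every index is eventually charged at least `e ≠ 0` and the
finite partial sums are frequently bounded by some `C < ∞`, the index type is finite — every finset
has `|s|·e ≤ C`, while an infinite type has finsets of every cardinality. -/
theorem finite_of_frequently_sum_le {ι : Type*} {F : ι → ℝ → ℝ≥0∞} {C e : ℝ≥0∞}
    (hsum : ∀ s : Finset ι, ∃ᶠ τ in atTop, ∑ i ∈ s, F i τ ≤ C) (hC : C < ⊤) (he : e ≠ 0)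
    (hev : ∀ i, ∀ᶠ τ in atTop, e ≤ F i τ) : Finite ι := by
  have hcard : ∀ s : Finset ι, (s.card : ℝ≥0∞) * e ≤ C := fun s ↦ by
    obtain ⟨τ, hτsum, hτall⟩ :=
      ((hsum s).and_eventually ((Filter.eventually_all_finset s).2 fun i _ ↦ hev i)).exists
    calc (s.card : ℝ≥0∞) * e = ∑ i ∈ s, e := by rw [Finset.sum_const, nsmul_eq_mul]
      _ ≤ ∑ i ∈ s, F i τ := Finset.sum_le_sum fun i hi ↦ hτall i hi
      _ ≤ C := hτsum
  by_contra hinf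
  rw [not_finite_iff_infinite] at hinf
  obtain ⟨n, hn⟩ := ENNReal.exists_nat_mul_gt he hC.ne
  obtain ⟨s, hs⟩ := Infinite.exists_subset_card_eq ι n
  have h := hcard s
  rw [hs] at h
  exact absurd (hn.trans_le h) (lt_irrefl _)

/-- THE CRUX BY NAME from the registered stubs. `dsimp only` ζ/β-reduces the crux's `let B`, `let G`;
an empty `ι` is finite; otherwise `0 < Mᵢ ≤ K` gives `0 < K`, and for each hole
`c/(2K) ≤ c/(2Mᵢ) < c/Mᵢ ≤ 𝓔_KS(Mᵢ, aᵢ)` (stub 3) `≤` boosted background collar value (stub 2)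
`= lim_τ 𝓔ᵢ(τ)` (stub 1), so `𝓔ᵢ(τ) > c/(2Mᵢ)` eventually (`Tendsto.eventually_const_lt`); the
counting lemma with `e = c/(2K)` finishes. -/
theorem InvertedQuantumCensus_of :
    Sig.stub_collarContinuity → Sig.stub_boostInflatesCollar → KerrCollarSuperenergyFloor →
      Summit.FinalStateConjecture.FinalStateConjecture.Theses.SuperenergyCensus.InvertedQuantumCensus := by
  intro hA hJ hF 𝓢 O ι mass spin motion τ₀ chart
  dsimp only
  rintro ⟨hsub, hlate, hconv⟩ ⟨K, hK⟩ ⟨C, hCtop, hSE⟩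
  rcases isEmpty_or_nonempty ι with hι | ⟨⟨i₀⟩⟩
  · infer_instance
  obtain ⟨c, hc, hfloor⟩ := hF
  have hpos : ∀ i, 0 < mass i := fun i ↦
    Literature.Geometry.Lorentzian.Kerr.IsSubextremal.pos (hsub i)
  have hKpos : 0 < K := (hpos i₀).trans_le (hK i₀)
  refine finite_of_frequently_sum_le hSE hCtop (e := ENNReal.ofReal (c / (2 * K)))
    (ENNReal.ofReal_pos.2 (by positivity)).ne' fun i ↦ ?_
  have h1 : ENNReal.ofReal (c / (2 * mass i)) < ENNReal.ofReal (c / mass i) := by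
    rw [ENNReal.ofReal_lt_ofReal_iff (div_pos hc (hpos i))]
    exact div_lt_div_of_pos_left hc (hpos i) (by linarith [hpos i])
  have h2 := hfloor (mass i) (spin i) (hpos i)
    (le_of_lt (hsub i : |spin i| < mass i))
  have h3 := hJ (mass i) (spin i) (motion i).1 (motion i).2 (hsub i)
  have h4 := (hA 𝓢 O (mass i) (spin i) (motion i).1 (motion i).2 τ₀ (chart i) (hsub i) (hlate i)
    (hconv i)).eventually_const_lt (h1.trans_le (h2.trans h3))
  have h0 : ENNReal.ofReal (c / (2 * K)) ≤ ENNReal.ofReal (c / (2 * mass i)) :=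
    ENNReal.ofReal_le_ofReal
      (div_le_div_of_nonneg_left hc.le (by linarith [hpos i]) (by linarith [hK i]))
  exact h4.mono fun τ hτ ↦ h0.trans hτ.le

/-! The crux by name, closed modulo the three registered stubs (kernel check that the stub
statements are literally the hypotheses of `InvertedQuantumCensus_of`; an `example`, so that the
composition above stays the file's only theorem concluding the crux). -/
example : Summit.FinalStateConjecture.FinalStateConjecture.Theses.SuperenergyCensus.InvertedQuantumCensus :=
  InvertedQuantumCensus_of stub_collarContinuity stub_boostInflatesCollar stub_kerrCollarFloor

end Summit.FinalStateConjecture.FinalStateConjecture.Cruxes.InvertedQuantumCensus.Birth
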